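import Literature.NumberTheory.CubicFields.CubicResolventCharacter
import Literature.NumberTheory.NumberFields.RayClassFieldOfCharacter
import Literature.NumberTheory.GaloisRepresentations.HeckeCharacterOfRayClass
import Summits.BirchSwinnertonDyer.BirchSwinnertonDyer.Theorems.ResidualThetaTransportAtTwoHeckeThetaPartnerAdicAtTwoTeichmullerTwistPrelim
import HarnessLib

/-!
# The cubic character of the `2`-division field is ramified at `2`: non-triviality on odd principal
# ideles (class field theory)

Route `ResidualThetaTransportAtTwo`, crux K0⁺ `HeckeThetaPartnerAdicAtTwo` (stmt-BirchSwinnertonDyer-20690),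
helper §D2 of the line "proof from print".  THEOREMS ONLY (no definition, no named fact, no `sorry`).

Setting.  `k` a number field, `P = (π)` a principal prime of `𝓞 k` (the inert `(2)`), `𝔪 ≠ 0` an ideal
coprime to `P`, `T` a finite set of primes containing `P` whose other members divide `𝔪`, and `ψ` a
function on the primes with `‖ψ(v)‖ = 1` off `T` (the prime-value function of the cubic Hecke character
`ω_χ` of an abelian cubic `L/k`, `CubicFields.cubicRayClassFunction_spec`).

* `isUnramifiedIn_of_charHecke_isUnramifiedAt` — **ramification of the class field is detected by the
  character**: for `L ⊆ k̄` finite abelian over `k` and an INJECTIVE character `χ` of `Gal(L/k)`, if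
  `ω_χ = χ ∘ ψ_{L|k}` is unramified at `v` then `L/k` is unramified at `v` (the tree's primitive Artin
  reciprocity `artinReciprocity_character_primitive_holds`, rigidity of Hecke characters, and the
  inertia group `I_𝔓|_L ≠ 1` at a ramified prime, `exists_mem_inertia_absRestrictNormalHom_ne_one` —
  the template of `RayClassFieldOfCharacter.exists_classField_of_isRayClassCharacter`).
* `exists_isRayClassCharacter_of_forall_idealPow_eq_one` — **the odd-modulus descent**: if
  `ψ̃((b)) = 1` for every `b ∉ P` with `b ≡ 1 mod 𝔪` (H0), then `ψ`, modified at the single prime `P`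
  by `ψ'(P) := ψ̃((β))` for any `β ≡ π mod 𝔪`, `β ∉ P`, is a ray class character MODULO `𝔪`
  (`LFunctions.IsRayClassCharacter 𝔪 ψ'`): factor `b = πⁱ b₀` and compare `βⁱ b₀ ≡ b`.
* `isUnramifiedAt_of_forall_idealPow_eq_one` — hence a Hecke character `ω` with `ω(ϖ_v) = ψ(v)` off
  `T` is unramified at `P`: the Hecke character of `ψ' mod 𝔪`
  (`HeckeCharacter.exists_of_isRayClassCharacter`) agrees with `ω` at almost all uniformizers, so equals
  it (`HeckeCharacter.ext_of_eventually_valueAtUniformizer_eq`), and it is unramified off `𝔪 ∌ P`.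
* `exists_idealPow_ne_one_of_not_isUnramifiedIn` — **contrapositive for `ω_χ`**: if `L/k` is ramified at
  `P` then some `b ∉ P`, `b ≡ 1 mod 𝔪`, has `ψ̃_χ((b)) ≠ 1` (with `…RamifiedAtTwo`: the cubic character
  of `ℚ(W[2])/ℚ(√Δ_W)` is non-trivial on the odd principal ideals `≡ 1 mod 𝔪`, i.e. genuinely ramified
  at the inert `2`).

References: Neukirch, *Algebraic Number Theory*, VI (6.6) ("`𝔭` is ramified in `L ⟺ 𝔭 ∣ 𝔣`"), VII
(6.9), (6.14); Tate in Cassels–Fröhlich, Ch. VII §4 Prop. 4.1, §5.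
-/

set_option autoImplicit false
set_option linter.dupNamespace false

noncomputable section

open scoped NumberField
open NumberField IsDedekindDomain Filter
open Literature.NumberTheory.NumberFields Literature.NumberTheory.GaloisRepresentations
  Literature.NumberTheory.Automorphic Literature.NumberTheory.LFunctions Literature.NumberTheory.CubicFields

namespace Summit.BirchSwinnertonDyer.BirchSwinnertonDyer.Theorems.HeckeThetaPartner

/-! ### Ramification of the class field is detected by an injective character -/

section Template

variable {K : Type} [Field K] [NumberField K]
  (E : IntermediateField K (AlgebraicClosure K)) [FiniteDimensional K E] [IsAbelianGalois K E] [NumberField E]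

/-- **If `ω_χ` is unramified at `v` then so is the class field**, for an injective character `χ` of the
abelian `Gal(E/K)`: the primitive reciprocity character of `ρ = χ ∘ r_E` is `ω_χ` (rigidity), so `ρ`
is unramified at `v`, i.e. kills the inertia groups `I_𝔓`, `𝔓 ∣ v`; if `v` were ramified in `E` some
`g ∈ I_𝔓` would act non-trivially on `E`, contradicting injectivity of `χ`.
[cite: NeukirchANT1999, Ch. VI §6 Cor. (6.6)] -/
theorem isUnramifiedIn_of_charHecke_isUnramifiedAt (χ : (E ≃ₐ[K] E) →* ℂˣ)
    (hχinj : Function.Injective χ) {v : HeightOneSpectrum (𝓞 K)}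
    (hωv : (charHecke E χ artinReciprocity_character_holds).IsUnramifiedAt v) :
    Algebra.IsUnramifiedIn (𝓞 E) v.asIdeal := by
  classical
  set hR := artinReciprocity_character_holds
  set ω := charHecke E χ hR with hωdef
  set ρ : FramedArtinRep K 1 := inflateCharacter E χ with hρdef
  have hcommE : ∀ a b : E ≃ₐ[K] E, Commute a b := commute_of_isAbelianGalois E
  -- `ρ` is unramified wherever `ω` is: the primitive reciprocity character of `ρ` is `ω`
  have hρunr : ∀ w : HeightOneSpectrum (𝓞 K), ω.IsUnramifiedAt w → ρ.IsUnramifiedAt w := by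
    obtain ⟨ω', -, hω'⟩ := artinReciprocity_character_primitive_holds (K := K) ρ
    have heq : ω' = ω := by
      apply HeckeCharacter.ext_of_eventually_valueAtUniformizer_eq
      have hunrE : ∀ᶠ w : HeightOneSpectrum (𝓞 K) in cofinite,
          Algebra.IsUnramifiedIn (𝓞 E) w.asIdeal :=
        Filter.eventually_cofinite.mpr (finite_setOf_not_isUnramifiedIn K E)
      filter_upwards [hunrE] with w hunr
      have hρw : ρ.IsUnramifiedAt w := inflateCharacter_isUnramifiedAt E χ hunr
      obtain ⟨𝔓w, h𝔓w⟩ := w.primesAbove_nonempty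
      obtain ⟨σ, hσ⟩ := HeightOneSpectrum.exists_isArithFrobAt_of_mem_primesAbove_holds h𝔓w
      rw [(hω' w).2 hρw 𝔓w h𝔓w σ hσ, hωdef, charHecke_valueAtUniformizer E χ hR hunr]
      haveI : 𝔓w.IsPrime := h𝔓w.1
      have hP := comap_ringOfIntegersToIntegralClosure_mem_primesOver_of_mem_primesAbove E h𝔓w
      have hrσ := isArithFrobAt_absRestrictNormalHom E hσ
      have hfrob : absRestrictNormalHom E σ = galFrob K E w := eq_galFrob hcommE hunr hP hrσ
      rw [FramedRep.det_apply, Matrix.GeneralLinearGroup.val_det_apply, Matrix.det_fin_one, hρdef,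
        inflateCharacter_apply_coe, hfrob]
    intro w hw
    have h := (hω' w).1
    rw [heq] at h
    exact h.mp hw
  -- if `v` were ramified, some inertia element would act non-trivially on `E`
  by_contra hram
  obtain ⟨𝔓, h𝔓, g, hg, hne⟩ := exists_mem_inertia_absRestrictNormalHom_ne_one (L := E) hram
  apply hne
  have h1 : ρ g = 1 := hρunr v hωv 𝔓 h𝔓 g hg
  rw [hρdef, inflateCharacter_apply] at h1
  have h2 : χ (absRestrictNormalHom E g) = 1 :=
    (FramedRep.unitsContinuousMulEquivOfUnique (Fin 1) ℂ).injective (by rw [h1, map_one])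
  exact hχinj (by rw [h2, map_one])

end Template

/-! ### Values of norm one -/

section NormOne

variable {K : Type*} [Field K] [NumberField K]

/-- If every prime dividing `I ≠ 0` has a value of norm `1` then `‖χ̃(I)‖ = 1`. [folklore] -/
theorem norm_idealPow_eq_one_of_forall (ψ : HeightOneSpectrum (𝓞 K) → ℂ) {I : Ideal (𝓞 K)} (hI : I ≠ ⊥)
    (h : ∀ v : HeightOneSpectrum (𝓞 K), I ≤ v.asIdeal → ‖ψ v‖ = 1) : ‖idealPow K ψ I‖ = 1 := by
  classical
  unfold idealPow
  rw [finprod_eq_prod _ (mulSupport_idealPow_finite ψ hI), norm_prod]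
  refine Finset.prod_eq_one fun v _ => ?_
  by_cases hc : (Associates.mk v.asIdeal).count (Associates.mk I).factors = 0
  · rw [hc, pow_zero, norm_one]
  · rw [norm_pow, h v (Ideal.le_of_dvd ((Associates.count_ne_zero_iff_dvd hI v.irreducible).mp hc)), one_pow]

end NormOne

/-! ### The odd-modulus descent -/

section Descent

variable {k : Type} [Field k] [NumberField k]

/-- **The odd-modulus descent.**  Let `P = (π)` be a principal prime of `𝓞 k`, `𝔪 ≠ 0` coprime to `P`,
`T` a finite set of primes containing `P` all of whose other members divide `𝔪`, and `ψ` a function on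
the primes of norm `1` off `T`.  If `ψ̃((b)) = 1` for every `b ∉ P`, `b ≡ 1 mod 𝔪` (H0), then there is a
ray class character `ψ' mod 𝔪` agreeing with `ψ` at every prime `≠ P`.  Construction: `ψ'(P) = ψ̃((β))`
for a `β ≡ π mod 𝔪`, `β ∉ P`; for `b = πⁱ b₀ ≡ c = πʲ c₀ mod 𝔪`, `ψ̃'((b)) = ψ̃((βⁱ b₀))`,
`ψ̃'((c)) = ψ̃((βʲ c₀))`, and `βⁱ b₀ ≡ βʲ c₀ mod 𝔪` are both prime to `P`, where H0 (through an inverse of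
`c` modulo `𝔪` prime to `P`) gives equality. [cite: NeukirchANT1999, Ch. VII §6 Def. (6.8)] -/
theorem exists_isRayClassCharacter_of_forall_idealPow_eq_one {π : 𝓞 k} (hπ : Prime π)
    {𝔪 : Ideal (𝓞 k)} (h𝔪 : 𝔪 ≠ ⊥) (h𝔪P : IsCoprime 𝔪 (Ideal.span {π}))
    (ψ : HeightOneSpectrum (𝓞 k) → ℂ) (T : Finset (HeightOneSpectrum (𝓞 k)))
    (hψT : ∀ v : HeightOneSpectrum (𝓞 k), v ∉ T → ‖ψ v‖ = 1)
    (hT𝔪 : ∀ v ∈ T, v.asIdeal ≠ Ideal.span {π} → 𝔪 ≤ v.asIdeal)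
    (H0 : ∀ b : 𝓞 k, b ≠ 0 → b ∉ Ideal.span {π} → b - 1 ∈ 𝔪 → idealPow k ψ (Ideal.span {b}) = 1) :
    ∃ ψ' : HeightOneSpectrum (𝓞 k) → ℂ, IsRayClassCharacter 𝔪 ψ' ∧
      ∀ v : HeightOneSpectrum (𝓞 k), v.asIdeal ≠ Ideal.span {π} → ψ' v = ψ v := by
  classical
  -- the prime `P = (π)`
  set P : Ideal (𝓞 k) := Ideal.span {π} with hPdef
  have hπ0 : π ≠ 0 := hπ.ne_zero
  have hP0 : P ≠ ⊥ := by rw [hPdef, Ne, Ideal.span_singleton_eq_bot]; exact hπ0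
  have hPprime : P.IsPrime := (Ideal.span_singleton_prime hπ0).mpr hπ
  haveI := hPprime
  have hPmax : P.IsMaximal := hPprime.isMaximal hP0
  let v₀ : HeightOneSpectrum (𝓞 k) := ⟨P, hPprime, hP0⟩
  have hv₀ : v₀.asIdeal = P := rfl
  have notMem_P : ∀ {b : 𝓞 k}, b ∉ P ↔ ¬ π ∣ b := fun {b} => by
    rw [hPdef, Ideal.mem_span_singleton]
  have span_ne_bot : ∀ {b : 𝓞 k}, b ≠ 0 → Ideal.span {b} ≠ ⊥ := fun hb => by
    rwa [Ne, Ideal.span_singleton_eq_bot]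
  -- a prime `≥ I` with `I` prime to `P` and to `𝔪` is not in `T`
  have notMem_T : ∀ {I : Ideal (𝓞 k)}, ¬ I ≤ P → IsCoprime I 𝔪 →
      ∀ v : HeightOneSpectrum (𝓞 k), I ≤ v.asIdeal → v ∉ T := by
    intro I hIP hI𝔪 v hIv hvT
    by_cases hvP : v.asIdeal = P
    · exact hIP (hvP ▸ hIv)
    · exact (isCoprime_iff_forall_not_le h𝔪).mp hI𝔪 v (hT𝔪 v hvT hvP) hIv
  have norm_one : ∀ {I : Ideal (𝓞 k)}, I ≠ ⊥ → ¬ I ≤ P → IsCoprime I 𝔪 → ‖idealPow k ψ I‖ = 1 :=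
    fun hI hIP hI𝔪 => norm_idealPow_eq_one_of_forall ψ hI fun v hv => hψT v (notMem_T hIP hI𝔪 v hv)
  have span_not_le : ∀ {b : 𝓞 k}, b ∉ P → ¬ Ideal.span {b} ≤ P := fun hb h =>
    hb (h (Ideal.mem_span_singleton_self _))
  -- H0 extended: `ψ̃((b)) = ψ̃((c))` for `b ≡ c mod 𝔪`, both prime to `P`, `c` prime to `𝔪`
  have H0' : ∀ b c : 𝓞 k, b ≠ 0 → c ≠ 0 → b ∉ P → c ∉ P → IsCoprime (Ideal.span {c}) 𝔪 →
      b - c ∈ 𝔪 → idealPow k ψ (Ideal.span {b}) = idealPow k ψ (Ideal.span {c}) := by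
    intro b c hb0 hc0 hbP hcP hc𝔪 hbc
    obtain ⟨d, hdP, hcd⟩ := exists_inverse_mod_notMem hPprime h𝔪P c hc𝔪
    have hd0 : d ≠ 0 := fun h => hdP (h ▸ P.zero_mem)
    have hbd : b * d - 1 ∈ 𝔪 := by
      have : b * d - 1 = (b - c) * d + (c * d - 1) := by ring
      rw [this]; exact 𝔪.add_mem (𝔪.mul_mem_right _ hbc) hcd
    have hbdP : b * d ∉ P := fun h => (hPprime.mem_or_mem h).elim hbP hdP
    have hcdP : c * d ∉ P := fun h => (hPprime.mem_or_mem h).elim hcP hdP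
    have h1 := H0 (b * d) (mul_ne_zero hb0 hd0) hbdP hbd
    have h2 := H0 (c * d) (mul_ne_zero hc0 hd0) hcdP hcd
    rw [← Ideal.span_singleton_mul_span_singleton, idealPow_mul ψ (span_ne_bot hb0) (span_ne_bot hd0)] at h1
    rw [← Ideal.span_singleton_mul_span_singleton, idealPow_mul ψ (span_ne_bot hc0) (span_ne_bot hd0)] at h2
    -- `ψ̃((d)) ≠ 0`
    have hd𝔪 : IsCoprime (Ideal.span {d}) 𝔪 := by
      have hcd𝔪 : IsCoprime (Ideal.span {c * d}) 𝔪 := by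
        refine Ideal.isCoprime_iff_exists.mpr ⟨c * d, Ideal.mem_span_singleton_self _, 1 - c * d, ?_, by ring⟩
        simpa using 𝔪.neg_mem hcd
      rw [← Ideal.span_singleton_mul_span_singleton] at hcd𝔪
      exact hcd𝔪.of_mul_left_right
    have hdne : idealPow k ψ (Ideal.span {d}) ≠ 0 := by
      intro h0
      have := norm_one (span_ne_bot hd0) (span_not_le hdP) hd𝔪
      rw [h0, norm_zero] at this
      exact zero_ne_one this
    exact mul_right_cancel₀ hdne (h1.trans h2.symm)
  -- `β ≡ π mod 𝔪`, `β ∉ P`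
  obtain ⟨m, hm𝔪, hmP⟩ : ∃ m ∈ 𝔪, m ∉ P := by
    obtain ⟨m, hm, y, hy, hmy⟩ := Ideal.isCoprime_iff_exists.mp h𝔪P
    refine ⟨m, hm, fun hmP' => hPprime.ne_top ?_⟩
    rw [Ideal.eq_top_iff_one, ← hmy]
    exact P.add_mem hmP' hy
  set β : 𝓞 k := π + m with hβdef
  have hβP : β ∉ P := fun h => hmP (by
    have : m = β - π := by rw [hβdef]; ring
    rw [this]; exact P.sub_mem h (Ideal.mem_span_singleton_self π))
  have hβ0 : β ≠ 0 := fun h => hβP (h ▸ P.zero_mem)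
  have hβπ : β - π ∈ 𝔪 := by rw [hβdef, add_sub_cancel_left]; exact hm𝔪
  have hπ𝔪 : IsCoprime (Ideal.span {π}) 𝔪 := h𝔪P.symm
  have hβ𝔪 : IsCoprime (Ideal.span {β}) 𝔪 := isCoprime_span_of_sub_mem hπ𝔪 hβπ
  -- the modified function
  let ψ' : HeightOneSpectrum (𝓞 k) → ℂ := fun v =>
    if v = v₀ then idealPow k ψ (Ideal.span {β}) else ψ v
  have hψ'v₀ : ψ' v₀ = idealPow k ψ (Ideal.span {β}) := by simp [ψ']
  have hψ'ne : ∀ v : HeightOneSpectrum (𝓞 k), v.asIdeal ≠ P → ψ' v = ψ v := by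
    intro v hv
    have : v ≠ v₀ := fun h => hv (by rw [h])
    simp [ψ', this]
  -- `ψ̃'` agrees with `ψ̃` on ideals not divisible by `P`
  have agree : ∀ {I : Ideal (𝓞 k)}, I ≠ ⊥ → ¬ I ≤ P → idealPow k ψ' I = idealPow k ψ I := by
    intro I hI hIP
    refine idealPow_congr_of_forall_le hI fun v hv => hψ'ne v fun hvP => hIP (hvP ▸ hv)
  -- factorisation `b = π^i b₀`
  have factor : ∀ {b : 𝓞 k}, b ≠ 0 → ∃ (i : ℕ) (b₀ : 𝓞 k), b₀ ∉ P ∧ b = π ^ i * b₀ := by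
    intro b hb
    obtain ⟨i, b₀, hb₀, rfl⟩ := WfDvdMonoid.max_power_factor hb hπ.irreducible
    exact ⟨i, b₀, notMem_P.mpr hb₀, rfl⟩
  -- the value of `ψ̃'` on `(π^i b₀)`
  have value : ∀ (i : ℕ) {b₀ : 𝓞 k}, b₀ ≠ 0 → b₀ ∉ P →
      idealPow k ψ' (Ideal.span {π ^ i * b₀}) = idealPow k ψ (Ideal.span {β ^ i * b₀}) := by
    intro i b₀ hb₀ hb₀P
    rw [← Ideal.span_singleton_mul_span_singleton, ← Ideal.span_singleton_mul_span_singleton,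
      ← Ideal.span_singleton_pow, ← Ideal.span_singleton_pow,
      idealPow_mul ψ' (pow_ne_zero i hP0) (span_ne_bot hb₀),
      idealPow_mul ψ (pow_ne_zero i (span_ne_bot hβ0)) (span_ne_bot hb₀),
      idealPow_pow ψ' hP0, idealPow_pow ψ (span_ne_bot hβ0), ← hv₀, idealPow_asIdeal, hψ'v₀,
      agree (span_ne_bot hb₀) (span_not_le hb₀P)]
  refine ⟨ψ', ⟨fun v hv => ?_, fun b c hb0 hc0 hc𝔪 hbc _ => ?_⟩, hψ'ne⟩
  · -- norm one off `𝔪`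
    by_cases hvP : v.asIdeal = P
    · have : v = v₀ := HeightOneSpectrum.ext hvP
      rw [this, hψ'v₀]
      exact norm_one (span_ne_bot hβ0) (span_not_le hβP) hβ𝔪
    · rw [hψ'ne v hvP]
      exact hψT v fun hvT => hv (hT𝔪 v hvT hvP)
  · -- the ray class property
    obtain ⟨i, b₀, hb₀P, rfl⟩ := factor hb0
    obtain ⟨j, c₀, hc₀P, rfl⟩ := factor hc0
    have hb₀0 : b₀ ≠ 0 := fun h => hb₀P (h ▸ P.zero_mem)
    have hc₀0 : c₀ ≠ 0 := fun h => hc₀P (h ▸ P.zero_mem)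
    rw [value i hb₀0 hb₀P, value j hc₀0 hc₀P]
    -- `β^i b₀`, `β^j c₀` are prime to `P`, congruent mod `𝔪`, and `β^j c₀` is prime to `𝔪`
    have hpowP : ∀ (n : ℕ) {x : 𝓞 k}, x ∉ P → β ^ n * x ∉ P := by
      intro n x hx h
      rcases hPprime.mem_or_mem h with h' | h'
      · exact hβP (hPprime.mem_of_pow_mem n h')
      · exact hx h'
    have hc₀𝔪 : IsCoprime (Ideal.span {c₀}) 𝔪 := by
      rw [Ideal.isCoprime_iff_sup_eq] at hc𝔪 ⊢
      refine eq_top_iff.mpr (hc𝔪.ge.trans (sup_le_sup_right ?_ _))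
      exact Ideal.span_singleton_le_span_singleton.mpr (Dvd.intro_left _ rfl)
    have hc'𝔪 : IsCoprime (Ideal.span {β ^ j * c₀}) 𝔪 := by
      rw [← Ideal.span_singleton_mul_span_singleton, ← Ideal.span_singleton_pow]
      exact IsCoprime.mul_left (IsCoprime.pow_left hβ𝔪) hc₀𝔪
    have hcongr : β ^ i * b₀ - β ^ j * c₀ ∈ 𝔪 := by
      rw [← Ideal.Quotient.eq] at hbc ⊢
      have hβq : Ideal.Quotient.mk 𝔪 β = Ideal.Quotient.mk 𝔪 π := Ideal.Quotient.eq.mpr hβπ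
      simp only [map_mul, map_pow, hβq] at hbc ⊢
      exact hbc
    exact H0' _ _ (mul_ne_zero (pow_ne_zero i hβ0) hb₀0) (mul_ne_zero (pow_ne_zero j hβ0) hc₀0)
      (hpowP i hb₀P) (hpowP j hc₀P) hc'𝔪 hcongr

/-- **Hence a Hecke character with prime values `ψ` off `T` is unramified at `P`** under H0: the Hecke
character of `ψ' mod 𝔪` (`HeckeCharacter.exists_of_isRayClassCharacter`) has the same values as `ω`
at almost all uniformizers, so it IS `ω` (rigidity), and it is unramified at `P ∤ 𝔪`.
[cite: CasselsFrohlichANT1967, Ch. VII §4 Prop. 4.1] -/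
theorem isUnramifiedAt_of_forall_idealPow_eq_one {π : 𝓞 k} (hπ : Prime π)
    {𝔪 : Ideal (𝓞 k)} (h𝔪 : 𝔪 ≠ ⊥) (h𝔪P : IsCoprime 𝔪 (Ideal.span {π}))
    (ψ : HeightOneSpectrum (𝓞 k) → ℂ) (T : Finset (HeightOneSpectrum (𝓞 k)))
    (hψT : ∀ v : HeightOneSpectrum (𝓞 k), v ∉ T → ‖ψ v‖ = 1)
    (hT𝔪 : ∀ v ∈ T, v.asIdeal ≠ Ideal.span {π} → 𝔪 ≤ v.asIdeal)
    (ω : HeckeCharacter k)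
    (hω : ∀ v : HeightOneSpectrum (𝓞 k), v ∉ T → ω.valueAtUniformizer v = ψ v)
    (H0 : ∀ b : 𝓞 k, b ≠ 0 → b ∉ Ideal.span {π} → b - 1 ∈ 𝔪 → idealPow k ψ (Ideal.span {b}) = 1)
    (v₀ : HeightOneSpectrum (𝓞 k)) (hv₀ : v₀.asIdeal = Ideal.span {π}) :
    ω.IsUnramifiedAt v₀ := by
  classical
  obtain ⟨ψ', hray, hψ'⟩ :=
    exists_isRayClassCharacter_of_forall_idealPow_eq_one hπ h𝔪 h𝔪P ψ T hψT hT𝔪 H0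
  obtain ⟨ω', -, hω'⟩ := HeckeCharacter.exists_of_isRayClassCharacter h𝔪 hray
  have hPprime : (Ideal.span {π}).IsPrime := (Ideal.span_singleton_prime hπ.ne_zero).mpr hπ
  -- `ω' = ω`
  have heq : ω' = ω := by
    apply HeckeCharacter.ext_of_eventually_valueAtUniformizer_eq
    have hfin : ({v : HeightOneSpectrum (𝓞 k) | 𝔪 ≤ v.asIdeal} ∪ (↑T ∪ {v₀})).Finite :=
      (finite_setOf_le_asIdeal h𝔪).union (T.finite_toSet.union (Set.finite_singleton v₀))
    refine (Filter.eventually_cofinite.mpr (hfin.subset fun v hv => ?_))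
    simp only [Set.mem_union, Set.mem_setOf_eq, Finset.mem_coe, Set.mem_singleton_iff]
    by_contra h
    push Not at h
    obtain ⟨h1, h2, h3⟩ := h
    apply hv
    rw [(hω' v h1).2, hω v h2, hψ' v (fun h4 => h3 (HeightOneSpectrum.ext (h4.trans hv₀.symm)))]
  have hv₀𝔪 : ¬ 𝔪 ≤ v₀.asIdeal := by
    intro hle
    have hP0 : Ideal.span {π} ≠ ⊥ := by rw [Ne, Ideal.span_singleton_eq_bot]; exact hπ.ne_zero
    exact (isCoprime_iff_forall_not_le hP0).mp h𝔪P v₀ (hv₀ ▸ le_rfl) hle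
  rw [← heq]
  exact (hω' v₀ hv₀𝔪).1

end Descent

/-! ### The cubic character of the `S₃`-closure: non-triviality at a ramified prime -/

section Cubic

variable {k : Type} [Field k] [NumberField k]
  (L : IntermediateField k (AlgebraicClosure k)) [FiniteDimensional k L] [IsAbelianGalois k L]
  [NumberField L]

open scoped Classical in
/-- **At a prime where `L/k` ramifies, the character of an injective `χ` is non-trivial on the principal
ideals `≡ 1 mod 𝔪` prime to it.**  For `L ⊆ k̄` abelian over `k`, `χ` injective, unramified outside the
finite set `T ∋ P = (π)` whose other members divide the modulus `𝔪` (coprime to `P`), with prime-value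
function `ψ = (v ↦ ω_χ(ϖ_v) off T, 0 on T)` (`CubicFields.cubicRayClassFunction_spec`): if `L/k` is
RAMIFIED at `P` there is `b ∉ P`, `b ≠ 0`, `b ≡ 1 mod 𝔪` with `ψ̃((b)) ≠ 1`.  (Otherwise `ω_χ` would be
unramified at `P` by `isUnramifiedAt_of_forall_idealPow_eq_one`, hence `L/k` unramified at `P` by
`isUnramifiedIn_of_charHecke_isUnramifiedAt`.) [cite: NeukirchANT1999, Ch. VI §6 Cor. (6.6)] -/
theorem exists_idealPow_ne_one_of_not_isUnramifiedIn (χ : (L ≃ₐ[k] L) →* ℂˣ)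
    (hχinj : Function.Injective χ) (T : Finset (HeightOneSpectrum (𝓞 k)))
    (hunr : ∀ v : HeightOneSpectrum (𝓞 k), v ∉ T → Algebra.IsUnramifiedIn (𝓞 L) v.asIdeal)
    {π : 𝓞 k} (hπ : Prime π) {𝔪 : Ideal (𝓞 k)} (h𝔪 : 𝔪 ≠ ⊥) (h𝔪P : IsCoprime 𝔪 (Ideal.span {π}))
    (hT𝔪 : ∀ v ∈ T, v.asIdeal ≠ Ideal.span {π} → 𝔪 ≤ v.asIdeal)
    (v₀ : HeightOneSpectrum (𝓞 k)) (hv₀ : v₀.asIdeal = Ideal.span {π})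
    (hram : ¬ Algebra.IsUnramifiedIn (𝓞 L) v₀.asIdeal) :
    ∃ b : 𝓞 k, b ≠ 0 ∧ b ∉ Ideal.span {π} ∧ b - 1 ∈ 𝔪 ∧
      idealPow k (fun v => if v ∈ T then (0 : ℂ) else
        (charHecke L χ artinReciprocity_character_holds).valueAtUniformizer v) (Ideal.span {b}) ≠ 1 := by
  by_contra hall
  push Not at hall
  set hR := artinReciprocity_character_holds
  set ψ := fun v : HeightOneSpectrum (𝓞 k) => if v ∈ T then (0 : ℂ) else
    (charHecke L χ hR).valueAtUniformizer v with hψdef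
  have hψT : ∀ v : HeightOneSpectrum (𝓞 k), v ∉ T → ‖ψ v‖ = 1 := by
    intro v hv
    rw [hψdef]
    simp only [if_neg hv]
    rw [charHecke_valueAtUniformizer L χ hR (hunr v hv)]
    have hfin : IsOfFinOrder (galFrob k L v) := isOfFinOrder_of_finite _
    obtain ⟨n, hn, hpow⟩ := hfin.exists_pow_eq_one
    have h1 : ((χ (galFrob k L v)) : ℂ) ^ n = 1 := by
      rw [← Units.val_pow_eq_pow_val, ← map_pow, hpow, map_one, Units.val_one]
    exact Complex.norm_eq_one_of_pow_eq_one h1 hn.ne'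
  have hω : ∀ v : HeightOneSpectrum (𝓞 k), v ∉ T → (charHecke L χ hR).valueAtUniformizer v = ψ v := by
    intro v hv; rw [hψdef]; simp only [if_neg hv]
  have hunr₀ := isUnramifiedAt_of_forall_idealPow_eq_one hπ h𝔪 h𝔪P ψ T hψT hT𝔪 (charHecke L χ hR) hω
    (fun b hb hbP hb1 => hall b hb hbP hb1) v₀ hv₀
  exact hram (isUnramifiedIn_of_charHecke_isUnramifiedAt L χ hχinj hunr₀)

end Cubic

end Summit.BirchSwinnertonDyer.BirchSwinnertonDyer.Theorems.HeckeThetaPartner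

end
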